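import Literature.NumberTheory.Weil1964.ArchUnitaryBallFrame
import Literature.NumberTheory.Weil1964.ArchSiegelGaussianAction
import HarnessLib

/-!
# The Cayley–Satake map `Z ↦ Φ(Z) = i(1 − Ẑ)(1 + Ẑ)⁻¹` from the bounded domain of `U(α, β)` into the Siegel half-space

Topic `NumberTheory/Weil1964`; namespace `Literature.NumberTheory.Weil1964.UnitaryBall`.  KERNEL throughout
(definitions with bodies and proved theorems only).  Sequel of `ArchUnitaryBall` / `ArchUnitaryBallFrame`.

For `Z` in the bounded domain `𝒟_{α,β} = {1 − ZᴴZ ≻ 0}` of `U(α, β)` put `Ẑ = (0 Z; Zᵀ 0)` — a complex SYMMETRIC matrix of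
size `α ⊕ β` in the Siegel disc `{1 − ŴᴴŴ ≻ 0}` — and `Φ(Z) = i(1 − Ẑ)(1 + Ẑ)⁻¹ = i(2(1 + Ẑ)⁻¹ − 1)`, its Cayley
transform.  This file proves:

* §1 positivity: `1 − ZZᴴ ≻ 0` on the domain (push-through / Woodbury identity
  `(1 − ZZᴴ)⁻¹ = 1 + Z(1 − ZᴴZ)⁻¹Zᴴ`), `1 − ẐᴴẐ = diag((1 − ZZᴴ)ᵀ, 1 − ZᴴZ) ≻ 0`, hence `1 + Ẑ` is invertible
  (if `Ẑy = −y` then `yᴴ(1 − ẐᴴẐ)y = 0`);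
* §2 `Φ(Z)` lies in the Siegel upper half-space `𝔥_{α⊕β}` of the tree (`siegelH`): it is symmetric and
  `Im Φ(Z) = (1 + Ẑ)⁻ᴴ (1 − ẐᴴẐ) (1 + Ẑ)⁻¹ ≻ 0`; `Φ(0) = i·1` is the base point of the Gaussian `e^{−π|y|²}`;
* §3 the scalar used to normalise Gaussians: `(1 − iΦ(Z))(1 + Ẑ) = 2`, so `det(1 − iΦ(Z)) · det(1 + Ẑ) = 2^n`.

`Φ` is the `U(α, β)`-equivariant holomorphic map of [Satake1965] (the bounded domain of `U(α,β)` sits in the Siegel disc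
as the off-diagonal symmetric matrices, followed by the Cayley transform of [Siegel1943, §2]); equivariance and the
factorisation of Folland's automorphy factor `j(g, τ)` along `Φ` are proved in the sequel `ArchUnitarySiegelEmbedding`.

## References

* [Siegel1943] C. L. Siegel, *Symplectic geometry*, Amer. J. Math. 65 (1943), §2 (Cayley transform disc ↔ half-space).
* [Satake1965] I. Satake, *Holomorphic imbeddings of symmetric domains into a Siegel space*, Amer. J. Math. 87 (1965).
* [Lee2004] M. H. Lee, *Mixed Automorphic Forms, Torus Bundles, and Jacobi Forms*, LNM 1845 (2004), §6.3.
-/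

set_option autoImplicit false

noncomputable section

open Matrix Complex
open scoped ComplexOrder ComplexConjugate

namespace Literature.NumberTheory.Weil1964

open Literature.RepresentationTheory.KonnoKonno2007 Literature.RepresentationTheory.KonnoKonno2007.RealDualPair
open Literature.NumberTheory.Automorphic Literature.NumberTheory.Automorphic.UnitaryGroup

namespace UnitaryBall

variable {α β : Type*} [Fintype α] [DecidableEq α] [Fintype β] [DecidableEq β]

/-- complexification of a real matrix of size `α ⊕ β` -/
local notation "RC" => RingHom.mapMatrix (m := α ⊕ β) Complex.ofRealHom

/-! ## 1. Positivity on the bounded domain -/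

/-- **`1 − ZZᴴ ≻ 0` on the domain** (push-through identity `(1 − ZZᴴ)(1 + Z(1 − ZᴴZ)⁻¹Zᴴ) = 1`: the inverse of
`1 − ZZᴴ` is `1 +` a positive semidefinite matrix). [cite: Lee2004, §6.3 (6.32)] -/
theorem posDef_one_sub_mul_conjTranspose {Z : Matrix α β ℂ} (hZ : Z ∈ ball α β) : (1 - Z * Zᴴ).PosDef := by
  classical
  have hP : (1 - Zᴴ * Z).PosDef := hZ
  have hPu : IsUnit (1 - Zᴴ * Z).det := (Matrix.isUnit_iff_isUnit_det _).1 hP.isUnit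
  have hM : (1 + Z * (1 - Zᴴ * Z)⁻¹ * Zᴴ).PosDef :=
    Matrix.PosDef.one.add_posSemidef (hP.inv.posSemidef.mul_mul_conjTranspose_same Z)
  have hinv : (1 - Z * Zᴴ) * (1 + Z * (1 - Zᴴ * Z)⁻¹ * Zᴴ) = 1 := by
    have h1 : (1 - Z * Zᴴ) * Z = Z * (1 - Zᴴ * Z) := by
      rw [Matrix.sub_mul, Matrix.one_mul, Matrix.mul_sub, Matrix.mul_one, Matrix.mul_assoc]
    calc (1 - Z * Zᴴ) * (1 + Z * (1 - Zᴴ * Z)⁻¹ * Zᴴ)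
        = (1 - Z * Zᴴ) + ((1 - Z * Zᴴ) * Z) * (1 - Zᴴ * Z)⁻¹ * Zᴴ := by
          simp only [Matrix.mul_add, Matrix.mul_one, Matrix.mul_assoc]
      _ = 1 := by
          rw [h1, Matrix.mul_assoc Z, Matrix.mul_nonsing_inv _ hPu, Matrix.mul_one, sub_add_cancel]
  rw [← Matrix.inv_eq_left_inv hinv]
  exact hM.inv

omit [Fintype α] [DecidableEq α] [Fintype β] [DecidableEq β] in
/-- **`Ẑ = (0 Z; Zᵀ 0)`** — the off-diagonal symmetric matrix of the bounded domain point `Z`. [cite: Lee2004, §6.3] -/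
def hatZ (Z : Matrix α β ℂ) : Matrix (α ⊕ β) (α ⊕ β) ℂ := Matrix.fromBlocks 0 Z Zᵀ 0

omit [Fintype α] [DecidableEq α] [Fintype β] [DecidableEq β] in
/-- `Ẑ` is symmetric. [cite: Lee2004, §6.3] -/
theorem hatZ_transpose (Z : Matrix α β ℂ) : (hatZ Z)ᵀ = hatZ Z := by
  rw [hatZ, Matrix.fromBlocks_transpose, Matrix.transpose_transpose, Matrix.transpose_zero, Matrix.transpose_zero]

omit [Fintype α] [DecidableEq α] [Fintype β] [DecidableEq β] in
/-- `0̂ = 0`. [cite: Lee2004, §6.3] -/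
theorem hatZ_zero : hatZ (0 : Matrix α β ℂ) = 0 := by
  rw [hatZ, Matrix.transpose_zero, Matrix.fromBlocks_zero]

omit [DecidableEq α] [DecidableEq β] in
/-- `ẐᴴẐ = diag((ZZᴴ)ᵀ, ZᴴZ)`. [cite: Lee2004, §6.3 (6.32)] -/
theorem conjTranspose_hatZ_mul_hatZ (Z : Matrix α β ℂ) :
    (hatZ Z)ᴴ * hatZ Z = Matrix.fromBlocks ((Z * Zᴴ)ᵀ) 0 0 (Zᴴ * Z) := by
  have h1 : (Zᵀ)ᴴ = Z.map star := by
    rw [Matrix.conjTranspose, Matrix.transpose_transpose]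
  have h2 : (Z * Zᴴ)ᵀ = Z.map star * Zᵀ := by
    rw [Matrix.transpose_mul, Matrix.conjTranspose, Matrix.transpose_map, Matrix.transpose_transpose]
  rw [hatZ, Matrix.fromBlocks_conjTranspose, Matrix.fromBlocks_multiply, h1, h2]
  simp

omit [DecidableEq α] [DecidableEq β] in
/-- A block-diagonal matrix with positive definite blocks is positive definite. [cite: Lee2004, §6.3 (6.32)] -/
theorem posDef_fromBlocks_diag {A : Matrix α α ℂ} {D : Matrix β β ℂ} (hA : A.PosDef) (hD : D.PosDef) :
    (Matrix.fromBlocks A 0 0 D).PosDef := by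
  refine Matrix.PosDef.of_dotProduct_mulVec_pos
    (Matrix.IsHermitian.fromBlocks hA.1 (by simp) hD.1) fun v hv => ?_
  rw [← Sum.elim_comp_inl_inr v, Matrix.fromBlocks_mulVec, Sum.elim_comp_inl, Sum.elim_comp_inr, star_sum_elim,
    sumElim_dotProduct_sumElim, Matrix.zero_mulVec, Matrix.zero_mulVec, add_zero, zero_add]
  by_cases hx : v ∘ Sum.inl = 0
  · have hy : v ∘ Sum.inr ≠ 0 := by
      intro hy; apply hv
      rw [← Sum.elim_comp_inl_inr v, hx, hy]
      ext (i | i) <;> rfl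
    rw [hx, Matrix.mulVec_zero, dotProduct_zero, zero_add]
    exact hD.dotProduct_mulVec_pos hy
  · exact add_pos_of_pos_of_nonneg (hA.dotProduct_mulVec_pos hx) (hD.posSemidef.dotProduct_mulVec_nonneg _)

/-- **`1 − ẐᴴẐ ≻ 0` on the domain** (`Ẑ` lies in the Siegel disc). [cite: Lee2004, §6.3 (6.32)] -/
theorem posDef_one_sub_hatZ {Z : Matrix α β ℂ} (hZ : Z ∈ ball α β) : (1 - (hatZ Z)ᴴ * hatZ Z).PosDef := by
  have h : (1 : Matrix (α ⊕ β) (α ⊕ β) ℂ) - (hatZ Z)ᴴ * hatZ Z = Matrix.fromBlocks (1 - Z * Zᴴ)ᵀ 0 0 (1 - Zᴴ * Z) := by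
    rw [conjTranspose_hatZ_mul_hatZ, ← Matrix.fromBlocks_one, Matrix.transpose_sub, Matrix.transpose_one]
    ext (i | i) (j | j) <;> simp [Matrix.one_apply]
  rw [h]
  exact posDef_fromBlocks_diag (posDef_one_sub_mul_conjTranspose hZ).transpose hZ

/-- **`1 + Ẑ` is invertible on the domain**: if `(1 + Ẑ)y = 0` then `Ẑy = −y` and `yᴴ(1 − ẐᴴẐ)y = |y|² − |y|² = 0`.
[cite: Siegel1943, §2] -/
theorem isUnit_one_add_hatZ {Z : Matrix α β ℂ} (hZ : Z ∈ ball α β) : IsUnit (1 + hatZ Z) := by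
  rw [← Matrix.mulVec_injective_iff_isUnit, ← Matrix.coe_mulVecLin]
  refine (injective_iff_map_eq_zero (Matrix.mulVecLin (1 + hatZ Z))).2 fun y hy => ?_
  rw [Matrix.mulVecLin_apply, Matrix.add_mulVec, Matrix.one_mulVec] at hy
  have hW : hatZ Z *ᵥ y = -y := eq_neg_of_add_eq_zero_right hy
  by_contra hy0
  have hpos := (posDef_one_sub_hatZ hZ).dotProduct_mulVec_pos hy0
  rw [Matrix.sub_mulVec, Matrix.one_mulVec, dotProduct_sub, ← Matrix.mulVec_mulVec,
    Matrix.dotProduct_mulVec (star y) (hatZ Z)ᴴ, ← Matrix.star_mulVec, hW, star_neg, neg_dotProduct, dotProduct_neg,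
    neg_neg, sub_self] at hpos
  exact lt_irrefl _ hpos

/-- `det(1 + Ẑ) ≠ 0` on the domain. [cite: Siegel1943, §2] -/
theorem det_one_add_hatZ_ne_zero {Z : Matrix α β ℂ} (hZ : Z ∈ ball α β) : (1 + hatZ Z).det ≠ 0 :=
  ((Matrix.isUnit_iff_isUnit_det _).1 (isUnit_one_add_hatZ hZ)).ne_zero

/-! ## 2. The Cayley–Satake map into the Siegel half-space -/

/-- **The Cayley–Satake map** `Φ(Z) = i(1 − Ẑ)(1 + Ẑ)⁻¹ = i(2(1 + Ẑ)⁻¹ − 1)`. [cite: Siegel1943, §2] -/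
def Φ (Z : Matrix α β ℂ) : Matrix (α ⊕ β) (α ⊕ β) ℂ := I • ((2 : ℂ) • (1 + hatZ Z)⁻¹ - 1)

/-- **`Φ(Z)(1 + Ẑ) = i(1 − Ẑ)`.** [cite: Siegel1943, §2] -/
theorem Φ_mul_one_add_hatZ {Z : Matrix α β ℂ} (hZ : Z ∈ ball α β) : Φ Z * (1 + hatZ Z) = I • (1 - hatZ Z) := by
  have hu : IsUnit (1 + hatZ Z).det := (Matrix.isUnit_iff_isUnit_det _).1 (isUnit_one_add_hatZ hZ)
  rw [Φ, Matrix.smul_mul, Matrix.sub_mul, Matrix.smul_mul, Matrix.nonsing_inv_mul _ hu, Matrix.one_mul]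
  congr 1
  rw [two_smul]
  abel

/-- **`Φ(0) = i·1`** — the base point (the parameter of the vacuum Gaussian). [cite: Folland1989, §4.5 (4.62)] -/
theorem Φ_zero : Φ (0 : Matrix α β ℂ) = I • (1 : Matrix (α ⊕ β) (α ⊕ β) ℂ) := by
  rw [Φ, hatZ_zero, add_zero, inv_one, two_smul, add_sub_cancel_right]

/-- **`(1 − iΦ(Z))(1 + Ẑ) = 2·1`.** [cite: Siegel1943, §2] -/
theorem one_sub_I_smul_Φ_mul {Z : Matrix α β ℂ} (hZ : Z ∈ ball α β) :
    (1 - I • Φ Z) * (1 + hatZ Z) = (2 : ℂ) • (1 : Matrix (α ⊕ β) (α ⊕ β) ℂ) := by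
  have hu : IsUnit (1 + hatZ Z).det := (Matrix.isUnit_iff_isUnit_det _).1 (isUnit_one_add_hatZ hZ)
  have h : (1 : Matrix (α ⊕ β) (α ⊕ β) ℂ) - I • Φ Z = (2 : ℂ) • (1 + hatZ Z)⁻¹ := by
    rw [Φ, smul_smul, I_mul_I, neg_one_smul, sub_neg_eq_add, add_sub_cancel]
  rw [h, Matrix.smul_mul, Matrix.nonsing_inv_mul _ hu]

/-- **`det(1 − iΦ(Z)) · det(1 + Ẑ) = 2ⁿ`**, `n = |α| + |β|`. [cite: Siegel1943, §2] -/
theorem det_one_sub_I_smul_Φ_mul_det {Z : Matrix α β ℂ} (hZ : Z ∈ ball α β) :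
    (1 - I • Φ Z).det * (1 + hatZ Z).det = 2 ^ Fintype.card (α ⊕ β) := by
  rw [← Matrix.det_mul, one_sub_I_smul_Φ_mul hZ, Matrix.det_smul, Matrix.det_one, mul_one]

/-- `det(1 − iΦ(Z)) ≠ 0` on the domain. [cite: Siegel1943, §2] -/
theorem det_one_sub_I_smul_Φ_ne_zero {Z : Matrix α β ℂ} (hZ : Z ∈ ball α β) : (1 - I • Φ Z).det ≠ 0 := by
  intro h
  have h2 := det_one_sub_I_smul_Φ_mul_det hZ
  rw [h, zero_mul] at h2
  exact pow_ne_zero _ two_ne_zero h2.symm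

/-- `Φ(Z)` is symmetric. [cite: Siegel1943, §2] -/
theorem Φ_isSymm (Z : Matrix α β ℂ) : (Φ Z).IsSymm := by
  have h1 : ((1 + hatZ Z)⁻¹)ᵀ = (1 + hatZ Z)⁻¹ := by
    rw [Matrix.transpose_nonsing_inv, Matrix.transpose_add, Matrix.transpose_one, hatZ_transpose]
  show (Φ Z)ᵀ = Φ Z
  rw [Φ, Matrix.transpose_smul, Matrix.transpose_sub, Matrix.transpose_smul, Matrix.transpose_one, h1]

/-- **`Φ(Z) − Φ(Z)ᴴ = 2i · (1 + Ẑ)⁻ᴴ (1 − ẐᴴẐ) (1 + Ẑ)⁻¹`** (the imaginary part of the Cayley transform).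
[cite: Siegel1943, §2] -/
theorem Φ_sub_conjTranspose {Z : Matrix α β ℂ} (hZ : Z ∈ ball α β) :
    Φ Z - (Φ Z)ᴴ = ((2 : ℂ) * I) • (((1 + hatZ Z)⁻¹)ᴴ * (1 - (hatZ Z)ᴴ * hatZ Z) * (1 + hatZ Z)⁻¹) := by
  have hu : IsUnit (1 + hatZ Z).det := (Matrix.isUnit_iff_isUnit_det _).1 (isUnit_one_add_hatZ hZ)
  have hu' : IsUnit (1 + hatZ Z)ᴴ.det := by
    rw [Matrix.det_conjTranspose, isUnit_iff_ne_zero, star_ne_zero]; exact det_one_add_hatZ_ne_zero hZ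
  set N := 1 + hatZ Z with hN
  -- `N⁻ᴴ (N + Nᴴ − NᴴN) N⁻¹ = N⁻¹ + N⁻ᴴ − 1` and `N + Nᴴ − NᴴN = 1 − ẐᴴẐ`
  have h1 : N + Nᴴ - Nᴴ * N = 1 - (hatZ Z)ᴴ * hatZ Z := by
    rw [hN, Matrix.conjTranspose_add, Matrix.conjTranspose_one, Matrix.add_mul, Matrix.one_mul, Matrix.mul_add,
      Matrix.mul_one]
    abel
  have h2 : (N⁻¹)ᴴ * (N + Nᴴ - Nᴴ * N) * N⁻¹ = N⁻¹ + (N⁻¹)ᴴ - 1 := by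
    rw [Matrix.conjTranspose_nonsing_inv, Matrix.mul_sub, Matrix.mul_add, Matrix.nonsing_inv_mul _ hu',
      ← Matrix.mul_assoc, Matrix.nonsing_inv_mul _ hu', Matrix.one_mul, Matrix.sub_mul, Matrix.add_mul,
      Matrix.one_mul, Matrix.mul_assoc, Matrix.mul_nonsing_inv _ hu, Matrix.mul_one]
    abel
  rw [← h1, h2, Φ, Matrix.conjTranspose_smul, Matrix.conjTranspose_sub, Matrix.conjTranspose_smul,
    Matrix.conjTranspose_one]
  have hI : star I = -I := Complex.conj_I
  have h2' : star (2 : ℂ) = 2 := by norm_num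
  rw [hI, h2', neg_smul, sub_neg_eq_add, ← smul_add, mul_comm (2 : ℂ) I, mul_smul]
  congr 1
  rw [smul_sub, smul_add, two_smul, two_smul, two_smul]
  abel

/-- **`Φ(Z)` lies in the Siegel upper half-space** for `Z` in the domain. [cite: Siegel1943, §2] -/
theorem Φ_mem_siegelH {Z : Matrix α β ℂ} (hZ : Z ∈ ball α β) : Φ Z ∈ siegelH (α ⊕ β) := by
  have hsymm := Φ_isSymm Z
  refine ⟨hsymm, ?_⟩
  have hu : IsUnit (1 + hatZ Z)⁻¹ :=
    (Matrix.isUnit_nonsing_inv_iff).2 (isUnit_one_add_hatZ hZ)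
  have hpos : (((1 + hatZ Z)⁻¹)ᴴ * (1 - (hatZ Z)ᴴ * hatZ Z) * (1 + hatZ Z)⁻¹).PosDef :=
    (posDef_one_sub_hatZ hZ).conjTranspose_mul_mul_same (Matrix.mulVec_injective_iff_isUnit.2 hu)
  have hRC : RC ((Φ Z).map Complex.im) = ((1 + hatZ Z)⁻¹)ᴴ * (1 - (hatZ Z)ᴴ * hatZ Z) * (1 + hatZ Z)⁻¹ := by
    have h := sub_conjTranspose_eq hsymm
    rw [Φ_sub_conjTranspose hZ] at h
    exact (smul_right_injective _ (mul_ne_zero two_ne_zero I_ne_zero) h).symm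
  refine posDef_of_posDef_RC ?_ (hRC ▸ hpos)
  exact hsymm.map _

end UnitaryBall

end Literature.NumberTheory.Weil1964
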